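import Summits.BirchSwinnertonDyer.BirchSwinnertonDyer.Theorems.SignedLowerHalvesKobayashiLowerHalfSemistableDefmuMuCarrierPinned
import HarnessLib

/-!
# Line «defmu» of crux 2 `KobayashiLowerHalfSemistable` (stmt-BirchSwinnertonDyer-19000) AT AN ODD PRIME — part 1/3: the frame data
# S1bʳ and the level-lowering prime S1aʳ at any odd `p`

Route-independent `Theorems` file of the cell `bsd-ssimc`, seat `bsd-line-slh-p2` (LEAD of crux 2, gen 18); part 1 of the «defmu at an odd
prime» series (parts 2/3: `…DefmuOddPrimeDescent.lean`, `…DefmuOddPrimeThree.lean`; memo `Cruxes/KobayashiLowerHalfSemistable/Lines/defmu-at-three.md`).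
HONEST FRAMING: nothing about any curve is asserted, NO summit statement is proved, BSD / the crux is NOT proved; every theorem is an
IMPLICATION from hypotheses displayed in full.
PURPOSE OF THE SERIES: in the landed `5 ≤ p` chain of the line (p625235, p625644, p629660) the hypothesis `5 ≤ p` is used only through
(i) `p ≠ 2`, (ii) `a_p = 0`, (iii) the TYPING of two named facts at `5 ≤ p` (BSTW Thm 6.17 `thm617_…_PRE`; the period unit
`realPeriodRat_eq_unit_mul_plusPeriod`) and (iv) Pollack–Weston's Lemma 2.1 normalisation being automatic (weights ∣ 12). So the
`p = 3` residual S7 `stub_threeResidual` of skeleton v5 reduces to the SAME print inputs as the `5 ≤ p` half plus two printed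
statements not typed in the tree at `p = 3` (BSTW Thm 6.17 at an odd supersingular prime — UNREFEREED PREPRINT claim, referee-flagged
at 3 as (3-ii)♭′ —, and Pollack–Weston 2011 Lemma 2.1 — PUBLISHED); part 3 proves S7's signature from these.

THIS PART: `definiteFieldSupplyFromR_odd` — S1bʳ at any odd `p` (p625235's proof VERBATIM: it used `5 ≤ p` only as `p ≠ 2`);
`ramifiedLevelPrimeR_odd_of_levelLowering` — S1aʳ at any odd `p` modulo modularity and Diamond 1995 BY NAME (p625644's proof VERBATIM).

References: [BurungaleSkinnerTianWan2024] arXiv:2409.01350v2 Part II §2.3; [Marcus2018] Ch. 3 Thm. 25; [Serre1972] §1.11 Prop. 12;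
[MatarNekovar2019] Prop. 5.26; [Ribet1990] Thm. 1.1; [Diamond1995RefinedSerre] Thm. 1.1.
-/

-- D-0017: single-problem summit, the namespace repeats the problem name by design.
set_option linter.dupNamespace false
set_option autoImplicit false

noncomputable section

open scoped Classical

open NumberField IsDedekindDomain Field CongruenceSubgroup
open Literature.NumberTheory.GaloisRepresentations
open Literature.NumberTheory.EllipticCurves Literature.NumberTheory.EllipticCurves.BurungaleSkinnerTianWan2024
open Literature.NumberTheory.EllipticCurves.ModularForms
open Literature.NumberTheory.Automorphic
open Summit.BirchSwinnertonDyer.BirchSwinnertonDyer.Theorems.SignedBaseChangeK1FrameData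
open Summit.BirchSwinnertonDyer.BirchSwinnertonDyer.Theorems.SignedBaseChangeK2RTransferDescent
open Summit.BirchSwinnertonDyer.BirchSwinnertonDyer.Theorems.SemistableDefmuAssembly

namespace Summit.BirchSwinnertonDyer.BirchSwinnertonDyer.Theorems.SemistableDefmuOddPrime

/-! ### §1. S1bʳ at any odd prime -/

/-- **Definite frame data on class X6 at ANY odd prime** (the `p ≠ 2` twin of S1bʳ
`SemistableDefiniteFrameData.definiteFieldSupplyFromR`, p625235, whose proof used `5 ≤ p` only through `p ≠ 2`; the body is that
proof VERBATIM with the hypothesis renamed): for an X6 pair `(W, p)`, `p` odd, `N = N_W`, any prime `q₀ ∣ N`: an imaginary quadratic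
`K` with `p` split into `v ≠ v̄`, `q₀` inert, every other `ℓ ∣ N` split, `2` split or `2 ∣ N`, `(N, d_K) = 1`; `q₀ ∥ N`; the embedding
datum `ι`; absolute irreducibility of every framing of `E_K[p]`; the canonical (cyclotomic, anticyclotomic) tower. An existence theorem
about auxiliary data; nothing about `L`-values or Selmer groups is asserted. [cite: BurungaleSkinnerTianWan2024, Part II §2.3 (choice of the auxiliary field L)]
[cite: Marcus2018, Ch. 3 Thm. 25] [cite: Serre1972, §1.11 Prop. 12] [cite: MatarNekovar2019, Prop. 5.26 (2) and (3) (p. 492)] -/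
theorem definiteFieldSupplyFromR_odd :
    ∀ (p : ℕ) [Fact p.Prime] (W : WeierstrassCurve ℚ) [W.IsElliptic] [W.IsGloballyMinimal] (N : ℕ),
    (N : ℤ) = W.conductorNorm ℤ → p ≠ 2 → Rank1Residual.ClassX6 W p →
    ∀ q₀ : ℕ, q₀.Prime → (q₀ : ℤ) ∣ W.conductorNorm ℤ →
      ¬ ((p : ℤ) ∣ padicValRat q₀ W.Δ) →
    ∃ (K : Type) (_ : Field K) (_ : NumberField K) (ι : PadicAlgCl p ≃+* ℂ)
      (v vbar : HeightOneSpectrum (𝓞 K)) (κ₁ κ₂ : ZpExtension K p) (γ₁ γ₂ : absoluteGaloisGroup K)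
      (_ : Fact (ZpExtension.IsTopGeneratorPair κ₁ κ₂ γ₁ γ₂)) (_ : NeZero (NumberField.discr K).natAbs),
      IsImaginaryQuadratic K ∧ ((Ideal.span {(p : ℤ)}).primesOver (𝓞 K)).ncard = 2 ∧
      ((p : ℕ) : 𝓞 K) ∈ v.asIdeal ∧ ((p : ℕ) : 𝓞 K) ∈ vbar.asIdeal ∧ vbar ≠ v ∧
      (∀ (w : InfinitePlace K) (k : 𝓞 K), k ∈ v.asIdeal ↔ ‖ι.symm (w.embedding (k : K))‖ < 1) ∧
      IsCoprime (N : ℤ) (NumberField.discr K) ∧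
      q₀.Prime ∧ q₀ ∣ N ∧ ¬ (q₀ ^ 2 ∣ N) ∧
      ((Ideal.span {(q₀ : ℤ)}).primesOver (𝓞 K)).ncard = 1 ∧
      (∀ ℓ : ℕ, ℓ.Prime → ℓ ∣ N → ℓ ≠ q₀ → ((Ideal.span {(ℓ : ℤ)}).primesOver (𝓞 K)).ncard = 2) ∧
      (((Ideal.span {(2 : ℤ)}).primesOver (𝓞 K)).ncard = 2 ∨ 2 ∣ N) ∧
      ¬ ((p : ℤ) ∣ padicValRat q₀ W.Δ) ∧
      (∀ ρ : ModPGaloisRep K (ZMod p) 2, (W.baseChange K).IsTorsionGaloisRep p ρ →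
        FramedRep.IsAbsolutelyIrreducible ρ) ∧
      κ₁.IsCyclotomic ∧ κ₂.IsAnticyclotomic ∧
      (∃ ζ : ℤ_[p]ˣ, IsOfFinOrder ζ ∧
        ((GaloisRep.cyclotomicCharacter K p γ₁ * ζ : ℤ_[p]ˣ) : ℤ_[p]) = (cyclotomicGenerator p : ℤ_[p])) := by
  intro p _ W _ _ N hN hp2 hX q₀ hq₀ hq₀N hval
  have hpP : p.Prime := Fact.out
  -- the conductor: `N ≠ 0`, square-free (semistable), `q₀ ∣ N`, `p ∤ N`
  have hNeq : N = W.conductorNorm ℤ := by exact_mod_cast hN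
  have hN0 : N ≠ 0 := by
    rw [hNeq]; exact (WeierstrassCurve.conductorNorm_pos_holds W).ne'
  have hsqf : Squarefree N := by
    rw [hNeq]
    exact (WeierstrassCurve.isSemistable_iff_squarefree_conductorNorm W).mp
      ((Rank1Residual.semistable_iff_isSemistable_int (W := W)).mp hX.2.1)
  have hq₀dvd : q₀ ∣ N := by
    rw [← hN] at hq₀N; exact_mod_cast hq₀N
  have hq₀sq : ¬ q₀ ^ 2 ∣ N := by
    intro h
    have := hsqf q₀ (by rw [← sq]; exact h)
    exact hq₀.not_isUnit (by simpa using this)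
  have hpN : ¬ p ∣ N := by
    rw [hNeq]; exact not_dvd_conductorNorm_of_hasGoodReductionAtPrime W hX.1.1
  have hpq₀ : p ≠ q₀ := fun h ↦ hpN (h ▸ hq₀dvd)
  -- §1 the field: `S = ({p, 2} ∪ primeFactors N) \ {q₀}` split, `T = {q₀}` inert, `d_K = -r`, `r > N`
  set S : Finset ℕ := (insert p (insert 2 N.primeFactors)).erase q₀ with hSdef
  have hS : ∀ ℓ ∈ S, ℓ.Prime := by
    intro ℓ hℓ
    rw [hSdef, Finset.mem_erase, Finset.mem_insert, Finset.mem_insert] at hℓ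
    rcases hℓ.2 with rfl | rfl | h
    · exact hpP
    · exact Nat.prime_two
    · exact Nat.prime_of_mem_primeFactors h
  have hT : ∀ q ∈ ({q₀} : Finset ℕ), q.Prime := by
    intro q hq; rw [Finset.mem_singleton] at hq; exact hq ▸ hq₀
  have hST : Disjoint S ({q₀} : Finset ℕ) := by
    rw [Finset.disjoint_singleton_right, hSdef]
    exact Finset.notMem_erase q₀ _
  obtain ⟨r, K, _, _, hr, hNr, -, -, -, h2, hdisc, hSsp, hTin, -⟩ :=
    Literature.NumberTheory.QuadraticFields.Quadratic.exists_imaginaryQuadratic_split_inert S {q₀} hS hT hST N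
  have hK : IsImaginaryQuadratic K :=
    ⟨h2, Literature.NumberTheory.QuadraticFields.Quadratic.isTotallyComplex_of_discr_neg h2
      (by rw [hdisc, neg_lt_zero]; exact_mod_cast hr.pos)⟩
  have hpS : p ∈ S := by
    rw [hSdef, Finset.mem_erase]; exact ⟨hpq₀, Finset.mem_insert_self _ _⟩
  have hsplit : ((Ideal.span {(p : ℤ)}).primesOver (𝓞 K)).ncard = 2 := (hSsp p hpS).2
  have hcop : IsCoprime (N : ℤ) (NumberField.discr K) := by
    rw [hdisc]; exact isCoprime_of_lt hr hN0 hNr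
  -- §2 the primes above `p`, §4 the embedding datum, §3 the canonical tower
  obtain ⟨v, vbar, hv, hvbar, hne⟩ := exists_pair_of_ncard_primesOver_eq_two hpP hsplit
  obtain ⟨ι, hι⟩ := exists_iota hK v hv
  obtain ⟨κ₁, κ₂, γ₁, γ₂, hpair, hcyc, hanti, hcan⟩ :=
    SignedBaseChangeK1FrameDataCanonical.exists_isTopGeneratorPair_isCyclotomic_isAnticyclotomic_canonical
      (p := p) hK hp2
  haveI : Fact (ZpExtension.IsTopGeneratorPair κ₁ κ₂ γ₁ γ₂) := ⟨hpair⟩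
  haveI : NeZero (NumberField.discr K).natAbs :=
    ⟨by rw [hdisc, Int.natAbs_neg, Int.natAbs_natCast]; exact hr.ne_zero⟩
  refine ⟨K, inferInstance, inferInstance, ι, v, vbar, κ₁, κ₂, γ₁, γ₂, inferInstance, inferInstance, hK, hsplit,
    hv, hvbar, hne, hι, hcop, hq₀, hq₀dvd, hq₀sq, ?_, ?_, ?_, hval, ?_, hcyc, hanti, hcan⟩
  · -- `q₀` inert
    exact (hTin q₀ (Finset.mem_singleton_self q₀)).2
  · -- every other bad prime splits
    intro ℓ hℓ hℓN hℓq
    refine (hSsp ℓ ?_).2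
    rw [hSdef, Finset.mem_erase, Finset.mem_insert, Finset.mem_insert]
    exact ⟨hℓq, Or.inr (Or.inr (Nat.mem_primeFactors.mpr ⟨hℓ, hℓN, hN0⟩))⟩
  · -- `2` splits, unless `2 = q₀` (then `2 ∣ N`)
    by_cases h2q : (2 : ℕ) = q₀
    · exact Or.inr (h2q ▸ hq₀dvd)
    · refine Or.inl ?_
      have h2S : 2 ∈ S := by
        rw [hSdef, Finset.mem_erase, Finset.mem_insert, Finset.mem_insert]
        exact ⟨h2q, Or.inr (Or.inl rfl)⟩
      exact_mod_cast (hSsp 2 h2S).2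
  · -- (irr_K) for every framing: good supersingular odd `p`, `p` split in `K`, `(N, d_K) = 1`
    intro ρ hρ
    exact SmallImageIrrK.isAbsolutelyIrreducible_baseChange_of_goodSS_of_split W p hp2 hX.1.1 hX.1.2 K h2 hN
      hcop hsplit ρ hρ

/-! ### §1b. S1aʳ at any odd prime -/

/-- **S1aʳ at any odd prime** (twin of `SemistableDefiniteFrameData.ramifiedLevelPrimeR_of_levelLowering`, p625644, whose proof used only
`p ≠ 2`): for an X6 pair `(W, p)`, `p` odd, some prime `q₀ ∣ N_W` has `p ∤ v_{q₀}(Δ_W)` — modularity `hmod` and Diamond 1995 / Ribet 1990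
level lowering `hLL` BY NAME (`SkinnerUrban2014.ram_of_semistable_of_irr`). CONDITIONAL; closes nothing. [cite: Ribet1990, Thm. 1.1]
[cite: Diamond1995RefinedSerre, Thm. 1.1] [cite: Serre1972, §1.11 Prop. 12] -/
theorem ramifiedLevelPrimeR_odd_of_levelLowering (hmod : ModularForms.exists_isNewformOf)
    (hLL : Literature.NumberTheory.Automorphic.diamond1995_refinedSerre) :
    ∀ (p : ℕ) [Fact p.Prime] (W : WeierstrassCurve ℚ) [W.IsElliptic] [W.IsGloballyMinimal],
    p ≠ 2 → Rank1Residual.ClassX6 W p →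
    ∃ q₀ : ℕ, q₀.Prime ∧ (q₀ : ℤ) ∣ W.conductorNorm ℤ ∧ ¬ ((p : ℤ) ∣ padicValRat q₀ W.Δ) := by
  intro p _ W _ _ hp2 hX
  have hirr : Rank1Residual.Irr W p :=
    hasIrreducibleModPGaloisRep_of_dvd_frobeniusTrace W p hp2
      (W.not_dvd_minimalDiscriminantInt_of_hasGoodReductionAtPrime' p hX.1.1) hX.1.2
  obtain ⟨ℓ, hℓ, -, hmult, hndvd⟩ :=
    SkinnerUrban2014.ram_of_semistable_of_irr hmod hLL W p hp2 hX.1.1 hX.2.1 hirr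
  refine ⟨ℓ, hℓ.out, ?_, ?_⟩
  · exact_mod_cast (W.dvd_conductorNorm_iff_not_hasGoodReductionAtPrime ℓ).mpr
      (Rank1Residual.not_hasGoodReductionAtPrime_of_hasMultiplicativeReductionAtPrime (W := W) ℓ hmult)
  · rw [← WeierstrassCurve.cast_minimalDiscriminantInt W, padicValRat.of_int]
    exact_mod_cast hndvd

end Summit.BirchSwinnertonDyer.BirchSwinnertonDyer.Theorems.SemistableDefmuOddPrime

end
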